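/-
Copyright (c) 2026 the pub-hodgecm-mathlib formalisation cell (harness21).  Prover seat hodgecm-mathlib-A-p19 (g24) — (U) road: U4 PAID, 2026-09-01.
-/
import Summits.HodgeConjecture.HodgeConjecture.Theorems.F0P3ArchTopFormWallCompatibleModRankOne   -- ★ p844954: U4 ⟸ (W2′) (over ★ p844932, p844761, p844742, p844714, p844847 …)
import Literature.NumberTheory.Automorphic.ArchRankOneLimitFormulaTopForm                       -- ★ p844963 (F0P3-p03 g12): `tendsto_deriv_two_sin_smul_orbitalIntegral_archLocalTopFormHaar` (−π·C)
import Literature.NumberTheory.Weil1964.UnitaryArchTopFormDiscConstantValue                     -- ★ p844953 (A-p06 g29): `toNNReal_setLIntegral_diagonal_one_eq_pi_mul_topFormDiscConstant` (π·C = V₂), over ★ p844942 `exists_topFormDiscConstant`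
import HarnessLib

/-!
# U4 HOLDS: `ArchTopFormWallCompatible L` for every CM field `L` — the registered in-house row `stub_WallCompat` (#177, closer ED. 29 «U PAID») is a THEOREM
# ((U) road, U4-DISCHARGE complete; LEAD F0P3a-plan (g10) WORDS T9-32 (4), T9-36, T9-40; owner A-p19 (g24); Rogawski 1990 §8.2 p. 118, §1.7 p. 6)

Cell `pub/hodgecm-mathlib`, F0∕P3a, crux H413 (`stmt-HodgeConjecture-24833`, `--supports … --as helper`); namespace
`Summit.HodgeConjecture.HodgeConjecture.Cruxes.H413.F0P3ArchTopFormWallCompatibleHolds`.  ONE THEOREM (kernel lane); no def, no `sorry`, no hypothesis.  HONEST LABEL: HC_CM is proved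
only modulo the 2 remaining named inputs (hLiu418 24832, h413 24833) until rung 0 closes; this file removes the ONE in-house row behind them: after the one-token fold
`stub_WallCompat := fun L _ _ _ => archTopFormWallCompatible_holds L` the books read «22 printed + 0 in-house».

THE ASSEMBLY (every brick ★): ★ p844954 `archTopFormWallCompatible_of_rankOneConstant` reduces U4 to (W2′) «Harish-Chandra's rank-one limit formula holds for the top-form Haar measure
`archLocalTopFormHaar L 2 (diagonal(β₀,β₂)) w` of the INDEFINITE `U(σ_w diag(β₀,β₂))(ℂ)` with the constant `−V₂`, `V₂ := (∫⁻_{source(J₁)} w₀ dλ).toNNReal`, `J₁ = diagonal (fun _ => 1)`»;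
★ p844963 (F0P3-p03 (g12)) proves that formula with the constant `−π·C` for any disc constant `C` of the top-form measure of `U(1,−1)` (`(μ^TF).map π = C • μ_hyp`, ★ HAT-BOX shape);
★ p844942∕p844953 (A-p06 (g29)) give such a `C` (`exists_topFormDiscConstant`) and `π·C = V₂` in exactly the junction's spelling (`toNNReal_setLIntegral_diagonal_one_eq_pi_mul_topFormDiscConstant`;
numerically `C = π²∕2`, `V₂ = π³∕2`, U4's (nc) constant `−V₂·V₁ = −π⁴∕2` — MEMO-U4-NC-v1 §0).  Upstream: (ii) ★ p844847 (A-p06), (cpt) transport ★ (F0P3-p03 g11∕g12), U1∕U2 ★ (A-p06 g28,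
A-p12 g20), U1′∕U3a∕U3∕U5∕junctions ★ (A-p19 g24), (J-nc) chain ★ (p07, p06, p05, B-p17 lineages).
* **`archTopFormWallCompatible_holds (L) : ArchTopFormWallCompatible L`**.
-/

set_option autoImplicit false
set_option linter.dupNamespace false

noncomputable section

open MeasureTheory Measure Set Filter Topology NumberField NumberField.InfinitePlace Matrix
open Literature.MeasureTheory.Group Literature.NumberTheory.Automorphic Literature.NumberTheory.Automorphic.UnitaryGroup
open Literature.NumberTheory.Weil1964 Literature.NumberTheory.Weil1964.UnitaryArchTopForm Literature.NumberTheory.Weil1964.UnitaryArchLocalTopForm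
open Literature.NumberTheory.Rogawski1990
open Summit.HodgeConjecture.HodgeConjecture.Cruxes.H413.F0P3ArchTopFormWallCompatible
open Summit.HodgeConjecture.HodgeConjecture.Cruxes.H413.F0P3ArchTopFormWallCompatibleModRankOne
open scoped ENNReal NNReal Classical Matrix MatrixGroups Matrix.Norms.Operator ContDiff ComplexConjugate

namespace Summit.HodgeConjecture.HodgeConjecture.Cruxes.H413.F0P3ArchTopFormWallCompatibleHolds

/-- **U4 HOLDS — ARCHIMEDEAN TOP-FORM WALL COMPATIBILITY** for every CM field `L`: ONE constant `V ≠ 0` such that at every complex place and every real non-degenerate diagonal carrier the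
local top-form wall-block measure has total mass `V` at the compact walls and (J-nc) constant `−V` at the noncompact walls.  (in-house statement ★ p844462, now a theorem; motivated by
Rogawski 1990 §8.2 p. 118 «the constant in the limit formula for `H′` differs by a sign from that for `H`», §1.7 p. 6; Varadarajan 1989 §6.4 Thm 22) -/
theorem archTopFormWallCompatible_holds (L : Type) [Field L] [NumberField L] [IsCMField L] : ArchTopFormWallCompatible L := by
  letI : MeasurableSpace (skewC 2 (Matrix.diagonal fun _ : Fin 2 => ((1 : ℝ) : ℂ))) := borel _
  haveI : BorelSpace (skewC 2 (Matrix.diagonal fun _ : Fin 2 => ((1 : ℝ) : ℂ))) := ⟨rfl⟩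
  letI : MeasurableSpace (skewC 1 (Matrix.diagonal fun _ : Fin 1 => ((1 : ℝ) : ℂ))) := borel _
  haveI : BorelSpace (skewC 1 (Matrix.diagonal fun _ : Fin 1 => ((1 : ℝ) : ℂ))) := ⟨rfl⟩
  refine archTopFormWallCompatible_of_rankOneConstant L ?_
  intro _ _ w β hβ hhermβ hlt
  -- the top-form disc constant `C` of `U(1,−1)` and `π·C = V₂` in the junction's spelling (★ A-p06 (g29))
  letI : MeasurableSpace (skewC 2 (Matrix.diagonal ![(1 : ℂ), -1])) := borel _
  haveI : BorelSpace (skewC 2 (Matrix.diagonal ![(1 : ℂ), -1])) := ⟨rfl⟩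
  letI : MeasurableSpace (skewC 2 (1 : Matrix (Fin 2) (Fin 2) ℂ)) := borel _
  haveI : BorelSpace (skewC 2 (1 : Matrix (Fin 2) (Fin 2) ℂ)) := ⟨rfl⟩
  obtain ⟨C, -, hC, -⟩ := exists_topFormDiscConstant L w
  have hconst : (-(Real.pi * C) : ℝ) =
      -(((∫⁻ X in cayleySourceC 2 (Matrix.diagonal fun _ : Fin 2 => ((1 : ℝ) : ℂ)),
            ENNReal.ofReal (cayleyWeightC 2 (Matrix.diagonal fun _ : Fin 2 => ((1 : ℝ) : ℂ)) X)
            ∂(lieStdLebesgueC 2 (Matrix.diagonal fun _ : Fin 2 => ((1 : ℝ) : ℂ)))).toNNReal : ℝ≥0) : ℝ) := by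
    rw [toNNReal_setLIntegral_diagonal_one_eq_pi_mul_topFormDiscConstant L w hC]
  -- the rank-one limit formula for the top-form block measure (★ F0P3-p03 (g12)), constant `−π·C`
  have hb : ∀ i, ![β 0, β 2] i ≠ 0 := fun i => by fin_cases i <;> simp [hβ]
  have hreal : ∀ i, (w.1.embedding (![β 0, β 2] i)).im = 0 := fun i => by
    fin_cases i <;> simpa using UnitaryGroup.im_embedding_eq_zero_of_complexConj_eq L w (hhermβ _)
  have hsgn : (w.1.embedding (![β 0, β 2] 0)).re * (w.1.embedding (![β 0, β 2] 1)).re < 0 := by simpa using hlt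
  intro f hf hfc z
  have h := tendsto_deriv_two_sin_smul_orbitalIntegral_archLocalTopFormHaar (E := ℂ) L w ![β 0, β 2] hb hreal hsgn C hC f hf hfc z
  rw [hconst] at h
  exact h

end Summit.HodgeConjecture.HodgeConjecture.Cruxes.H413.F0P3ArchTopFormWallCompatibleHolds

end
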